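import Summits.NavierStokesRegularity.OSWSelfSimilar.SheetREvenSecondVariation
import Summits.NavierStokesRegularity.OSWSelfSimilar.SheetRCentreReencoding
import Summits.NavierStokesRegularity.OSWSelfSimilar.SheetRGeneratorEvenWeak
import Summits.NavierStokesRegularity.OSWSelfSimilar.SheetREvenLinearisationPerturbation
import HarnessLib

/-!
# SHEET-ℝ, EVEN half of Z3-SR-SPEC: the TWO ENCODINGS of the linearisation at `Ω* = Ω̄ + u` on the even zero-mass class have the same weak
# form — re-encoding of the Gårding datum, of the even resolvent and of the even Evans function

HONEST FRAMING (cell ns-blowup GROUP B / zone Z3, case Z3-SR-SPEC EVEN half, step (S1⁺)/(S2⁺) bookkeeping between the CENTRE encoding and the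
`Ω*` encoding; 1-D MODEL certificate frame (viscous gCLM/OSW sheet on the line); not Euler/NS; «violates: none — MODEL»). Nothing here asserts that a
profile exists; no interval arithmetic; no number of record moves.  The EVEN twin of cert-5 g6's `SheetRCentreReencoding` (odd class), whose §1
(`ae_eq_add_der`, `hilbert_add`, `velocity_add` — facts about the two CENTRES `Ω̄`, `Ω*`, parity-independent) is reused verbatim.

THE TWO ENCODINGS of the even linearisation at the certified zero `Ω* = Ω̄ + u₀` (`u₀ = prim (der u)`, `u ∈ Esp`), acting on `δ = profile p`, `p ∈ EspE`:
* the `Ω*` ENCODING (cert-5 g9's `SheetRTranslationModeWeakEigen`, keyed on a centre datum `hcs` for `Ω*` itself): coefficients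
  `d* = drift a Ω* = ½ξ + a𝒰Ω*`, `V* = potential L λ Ω* = 1 − HΩ* + λχ`, and `K* = −PopCE* + F′`;
* the CENTRE ENCODING (cert-5 g9's (P8⁺) files `SheetREvenLinearisationPerturbation` + `SheetREvenSecondVariation`, keyed on `hc` for `Ω̄`):
  `d̄ = drift a Ω̄`, `V̄ = potential L λ Ω̄`, and `K̄⁺_u = −PopCĒ + F′ + B⁺_u` with `B⁺_u = secondVariationE hL a u`, `‖B⁺_u‖ ≤ Δ⁺/2`.
They are THE SAME OPERATOR `A⁺*_F = DG⁺(Ω*) + F′`: §2 `weakForm_reencodeE` proves, for every `p ∈ EspE` and every ZERO-MASS even test,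
`linForm L d* V* δ δ′ φ φ₁ + ∫ w·(K*p)·φ = linForm L d̄ V̄ δ δ′ φ φ₁ + ∫ w·(K̄⁺_u p)·φ` (pointwise a.e. identity of the integrands, using `Ω*₁ = Ω̄₁ + u₁`
a.e., `HΩ* = HΩ̄ + Hu₀`, `𝒰Ω* = 𝒰Ω̄ + 𝒰u₀`). Consequences: `gardingDataKE_reencode` (a datum `(c, m)` for the centre encoding is a datum `(c, m)` for the
`Ω*` encoding), `isWeakImageE_reencode`, and — by weak uniqueness — `pairOpKE_reencode`, `resolventKE_reencode`, `resolventEven_reencode`,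
**`evansEven_reencode`**: the even Evans function of selfsim g14 does not depend on the encoding.  So the (P8⁺) allowance, proved for the centre encoding
(`evansEven_pert_of_record`), transfers to the `Ω*`-encoded Evans function whose zero at `½` is the translation mode.
No definition, no named fact.  WHAT THIS IS NOT: not NS; not the spectral certificate.
-/

noncomputable section

namespace Summit.NavierStokesRegularity.OSWSelfSimilar
namespace SheetREvenCentreReencoding

open _root_.MeasureTheory _root_.Set _root_.Filter _root_.Real Literature.Analysis.Fourier SheetRWeakProfilePV SheetRWeakToStrong
  SheetREnergyClass SheetRWeightedMeasure SheetRWeightedEmbeddings SheetREnergySpace SheetRLinearisedTests SheetRTestSpace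
  SheetRLinearisedFormBounds SheetRSolutionOperator SheetRComplexPivot SheetRAssemblyOperators SheetRCertificateAssembly
  SheetRWeakPairingExpansion SheetRCentreReencoding SheetREvenTests SheetREvenEnergySpace SheetREvenForms SheetREvenPairOperator
  SheetREvenPairUniqueness SheetREvenResolvent SheetREvenResolventIdentity SheetREvenClass SheetRResolventEvenClass SheetRGeneratorEvenWeak
  SheetREvansEven SheetREvenEnergyClass SheetREvenAssemblyOperators SheetREvenSecondVariation SheetREvenLinearisationPerturbation
open scoped Topology ENNReal

variable {L : ℝ} (hL : 0 < L) (lam a : ℝ) {Ω Ω₁ Ωs Ωs₁ : ℝ → ℝ} {H₀ Hs : ℝ}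
  (hc : IsCentre L Ω Ω₁ H₀) (hcs : IsCentre L Ωs Ωs₁ Hs) (u : Esp L hL) (hsum : ∀ y, Ωs y = Ω y + prim (der u) y)

/-! ### §1 (The data integral `∫ w g v = PdataE hL g ((v, v₁), _)` on a zero-mass even test is `integral_weight_mul_eq_PdataE` of
`SheetREvenLinearisationPerturbation`.) -/

/-! ### §2 The weak forms of the two encodings coincide -/

include hc hcs hsum in
/-- **RE-ENCODING OF THE EVEN WEAK FORM.** For `p ∈ EspE` (profile `δ = profile p`, `δ′ = derE p`), a bounded `F′ : EspE →L L²_w` and a ZERO-MASS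
compactly supported even test `(φ, φ₁)`:
`linForm L (drift a Ω*) (potential L λ Ω*) δ δ′ φ φ₁ + ∫ w·((−PopCE* + F′)p)·φ
   = linForm L (drift a Ω̄) (potential L λ Ω̄) δ δ′ φ φ₁ + ∫ w·((−PopCĒ + F′ + B⁺_u)p)·φ`.
MODEL statement; not NS. [folklore] -/
theorem weakForm_reencodeE (F' : EspE L hL →L[ℝ] W L) (p : EspE L hL) {φ φ₁ : ℝ → ℝ} (hφ : IsCompactTestE φ φ₁) (h0 : ∫ y, φ y = 0) :
    linForm L (drift a Ωs) (potential L lam Ωs) (profile p) (derE p) φ φ₁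
        + ∫ y, (L ^ 2 + y ^ 2) * ((((-PopCE hL lam a hcs + F') p : W L) : ℝ → ℝ) y * φ y) =
      linForm L (drift a Ω) (potential L lam Ω) (profile p) (derE p) φ φ₁
        + ∫ y, (L ^ 2 + y ^ 2) *
          ((((-PopCE hL lam a hc + F' + secondVariationE hL a u) p : W L) : ℝ → ℝ) y * φ y) := by
  have hφa := hφ.toIsCompactTestAny
  obtain ⟨hdm, hVm, hd, hV⟩ := coef_bounds hL lam a hc
  obtain ⟨hdms, hVms, hds, hVs⟩ := coef_bounds hL lam a hcs
  obtain ⟨hpm, hp1m, hp0, hp1, -, -⟩ := profileE_facts hL p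
  -- integrability of the two weak-form integrands
  obtain ⟨hIs, -⟩ := abs_linForm_le_any (d := drift a Ωs) (V := potential L lam Ωs) hL hdms hVms (by norm_num : (0:ℝ) ≤ 1 / 2) hds hVs hφa
    hpm hp1m hp0 hp1
  obtain ⟨hI, -⟩ := abs_linForm_le_any (d := drift a Ω) (V := potential L lam Ω) hL hdm hVm (by norm_num : (0:ℝ) ≤ 1 / 2) hd hV hφa
    hpm hp1m hp0 hp1
  -- the `P⁺`-terms and the `B⁺_u`-term as integrals of functions
  have hPs : ∫ y, (L ^ 2 + y ^ 2) * (((PopCE hL lam a hcs p : W L) : ℝ → ℝ) y * φ y) =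
      ∫ y, (L ^ 2 + y ^ 2) * (PopEFun L lam a Ωs Ωs₁ p y * φ y) :=
    integral_congr_ae ((PopCE_apply hL lam a hcs p).mono fun y hy => by simp only [hy])
  have hP : ∫ y, (L ^ 2 + y ^ 2) * (((PopCE hL lam a hc p : W L) : ℝ → ℝ) y * φ y) =
      ∫ y, (L ^ 2 + y ^ 2) * (PopEFun L lam a Ω Ω₁ p y * φ y) :=
    integral_congr_ae ((PopCE_apply hL lam a hc p).mono fun y hy => by simp only [hy])
  have hBae := (secondVariationE_apply hL a u p).1
  have hB : ∫ y, (L ^ 2 + y ^ 2) * (((secondVariationE hL a u p : W L) : ℝ → ℝ) y * φ y) =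
      ∫ y, (L ^ 2 + y ^ 2) * (secondVariationEFun L a u p y * φ y) :=
    integral_congr_ae (hBae.mono fun y hy => by simp only [hy])
  have iPs : Integrable fun y => (L ^ 2 + y ^ 2) * (PopEFun L lam a Ωs Ωs₁ p y * φ y) :=
    (integrable_weight_mul_any hL (PopCE hL lam a hcs p) hφa).1.congr ((PopCE_apply hL lam a hcs p).mono fun y hy => by simp only [hy])
  have iP : Integrable fun y => (L ^ 2 + y ^ 2) * (PopEFun L lam a Ω Ω₁ p y * φ y) :=
    (integrable_weight_mul_any hL (PopCE hL lam a hc p) hφa).1.congr ((PopCE_apply hL lam a hc p).mono fun y hy => by simp only [hy])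
  have iB : Integrable fun y => (L ^ 2 + y ^ 2) * (secondVariationEFun L a u p y * φ y) :=
    (integrable_weight_mul_any hL (secondVariationE hL a u p) hφa).1.congr (hBae.mono fun y hy => by simp only [hy])
  -- the pointwise identity (a.e., where `Ω*₁ = Ω̄₁ + u₁`)
  have key : ∀ᵐ y : ℝ,
      ((L ^ 2 + y ^ 2) * (derE p y * φ₁ y) + 2 * y * (derE p y * φ y) + (L ^ 2 + y ^ 2) * drift a Ωs y * (derE p y * φ y)
          + (L ^ 2 + y ^ 2) * potential L lam Ωs y * (profile p y * φ y))
        - (L ^ 2 + y ^ 2) * (PopEFun L lam a Ωs Ωs₁ p y * φ y) =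
      ((L ^ 2 + y ^ 2) * (derE p y * φ₁ y) + 2 * y * (derE p y * φ y) + (L ^ 2 + y ^ 2) * drift a Ω y * (derE p y * φ y)
          + (L ^ 2 + y ^ 2) * potential L lam Ω y * (profile p y * φ y))
        - (L ^ 2 + y ^ 2) * (PopEFun L lam a Ω Ω₁ p y * φ y)
        + (L ^ 2 + y ^ 2) * (secondVariationEFun L a u p y * φ y) := by
    filter_upwards [ae_eq_add_der hL hc hcs u hsum] with y hy
    simp only [drift, potential, PopEFun, secondVariationEFun]
    rw [hilbert_add hL hc u hsum y, velocity_add hL hc u hsum y, hy, hsum y]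
    ring
  have hlinS : linForm L (drift a Ωs) (potential L lam Ωs) (profile p) (derE p) φ φ₁ =
      ∫ y, ((L ^ 2 + y ^ 2) * (derE p y * φ₁ y) + 2 * y * (derE p y * φ y) + (L ^ 2 + y ^ 2) * drift a Ωs y * (derE p y * φ y)
          + (L ^ 2 + y ^ 2) * potential L lam Ωs y * (profile p y * φ y)) := rfl
  have hlin : linForm L (drift a Ω) (potential L lam Ω) (profile p) (derE p) φ φ₁ =
      ∫ y, ((L ^ 2 + y ^ 2) * (derE p y * φ₁ y) + 2 * y * (derE p y * φ y) + (L ^ 2 + y ^ 2) * drift a Ω y * (derE p y * φ y)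
          + (L ^ 2 + y ^ 2) * potential L lam Ω y * (profile p y * φ y)) := rfl
  have eInt := integral_congr_ae key
  have eL : (∫ y, ((L ^ 2 + y ^ 2) * (derE p y * φ₁ y) + 2 * y * (derE p y * φ y) + (L ^ 2 + y ^ 2) * drift a Ωs y * (derE p y * φ y)
          + (L ^ 2 + y ^ 2) * potential L lam Ωs y * (profile p y * φ y))
        - (L ^ 2 + y ^ 2) * (PopEFun L lam a Ωs Ωs₁ p y * φ y)) =
      (∫ y, ((L ^ 2 + y ^ 2) * (derE p y * φ₁ y) + 2 * y * (derE p y * φ y) + (L ^ 2 + y ^ 2) * drift a Ωs y * (derE p y * φ y)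
          + (L ^ 2 + y ^ 2) * potential L lam Ωs y * (profile p y * φ y)))
        - ∫ y, (L ^ 2 + y ^ 2) * (PopEFun L lam a Ωs Ωs₁ p y * φ y) := integral_sub hIs iPs
  have eR : (∫ y, ((L ^ 2 + y ^ 2) * (derE p y * φ₁ y) + 2 * y * (derE p y * φ y) + (L ^ 2 + y ^ 2) * drift a Ω y * (derE p y * φ y)
          + (L ^ 2 + y ^ 2) * potential L lam Ω y * (profile p y * φ y))
        - (L ^ 2 + y ^ 2) * (PopEFun L lam a Ω Ω₁ p y * φ y)
        + (L ^ 2 + y ^ 2) * (secondVariationEFun L a u p y * φ y)) =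
      (∫ y, ((L ^ 2 + y ^ 2) * (derE p y * φ₁ y) + 2 * y * (derE p y * φ y) + (L ^ 2 + y ^ 2) * drift a Ω y * (derE p y * φ y)
          + (L ^ 2 + y ^ 2) * potential L lam Ω y * (profile p y * φ y)))
        - (∫ y, (L ^ 2 + y ^ 2) * (PopEFun L lam a Ω Ω₁ p y * φ y))
        + ∫ y, (L ^ 2 + y ^ 2) * (secondVariationEFun L a u p y * φ y) := by
    rw [integral_add _ iB, integral_sub hI iP]
    exact hI.sub iP
  -- the `K`-terms through `PdataE`
  have hKs : ∫ y, (L ^ 2 + y ^ 2) * ((((-PopCE hL lam a hcs + F') p : W L) : ℝ → ℝ) y * φ y) =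
      -(∫ y, (L ^ 2 + y ^ 2) * (((PopCE hL lam a hcs p : W L) : ℝ → ℝ) y * φ y))
        + ∫ y, (L ^ 2 + y ^ 2) * (((F' p : W L) : ℝ → ℝ) y * φ y) := by
    rw [integral_weight_mul_eq_PdataE hL _ hφ h0, integral_weight_mul_eq_PdataE hL _ hφ h0, integral_weight_mul_eq_PdataE hL _ hφ h0,
      _root_.add_apply, _root_.neg_apply, map_add (PdataE hL), map_neg (PdataE hL), LinearMap.add_apply, LinearMap.neg_apply]
  have hK : ∫ y, (L ^ 2 + y ^ 2) * ((((-PopCE hL lam a hc + F' + secondVariationE hL a u) p : W L) : ℝ → ℝ) y * φ y) =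
      -(∫ y, (L ^ 2 + y ^ 2) * (((PopCE hL lam a hc p : W L) : ℝ → ℝ) y * φ y))
        + (∫ y, (L ^ 2 + y ^ 2) * (((F' p : W L) : ℝ → ℝ) y * φ y))
        + ∫ y, (L ^ 2 + y ^ 2) * (((secondVariationE hL a u p : W L) : ℝ → ℝ) y * φ y) := by
    rw [integral_weight_mul_eq_PdataE hL _ hφ h0, integral_weight_mul_eq_PdataE hL (PopCE hL lam a hc p) hφ h0,
      integral_weight_mul_eq_PdataE hL (F' p) hφ h0, integral_weight_mul_eq_PdataE hL (secondVariationE hL a u p) hφ h0,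
      _root_.add_apply, _root_.add_apply, _root_.neg_apply, map_add (PdataE hL), map_add (PdataE hL), map_neg (PdataE hL),
      LinearMap.add_apply, LinearMap.add_apply, LinearMap.neg_apply]
  rw [hKs, hK, hPs, hP, hB, hlinS, hlin]
  linarith

/-! ### §3 Re-encoding the Gårding datum and the weak image -/

include hc hcs hsum in
/-- **THE (S1⁺) DATUM, RE-ENCODED (centre → `Ω*`).** A Gårding datum `(c, m)` for the centre encoding
`(drift a Ω̄, potential L λ Ω̄, −PopCĒ + F′ + B⁺_u)` — the output of (P8⁺)'s `gardingDataKE_of_record` — is a Gårding datum `(c, m)` for the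
`Ω*` encoding `(drift a Ω*, potential L λ Ω*, −PopCE* + F′)` (coefficient fields from `coef_bounds` at `Ω*`: `D₀* = |a|(π/(4L))^{1/2}‖Ω*‖_w`,
`D₁ = ½`, `V₀* = 1 + H₀* + |λ|`). MODEL statement; not NS. [folklore] -/
theorem gardingDataKE_reencode (F' : EspE L hL →L[ℝ] W L) {D₀ D₁ V₀ c m : ℝ}
    (h : GardingDataKE L hL (drift a Ω) (potential L lam Ω) (-PopCE hL lam a hc + F' + secondVariationE hL a u) D₀ D₁ V₀ c m) :
    GardingDataKE L hL (drift a Ωs) (potential L lam Ωs) (-PopCE hL lam a hcs + F')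
      (|a| * (Real.sqrt (π / (4 * L)) * Real.sqrt (∫ y, (L ^ 2 + y ^ 2) * Ωs y ^ 2))) (1 / 2) (1 + Hs + |lam|) c m := by
  obtain ⟨hdms, hVms, hds, hVs⟩ := coef_bounds hL lam a hcs
  refine ⟨hdms, hVms, by positivity, by norm_num, hds, hVs, h.c_pos, fun vp => ?_⟩
  have hG := h.garding vp
  obtain ⟨hae, -, hprof⟩ := jmapE_snd_ae hL vp
  have e1 : linForm L (drift a Ω) (potential L lam Ω) vp.1.1 vp.1.2 vp.1.1 vp.1.2 =
      linForm L (drift a Ω) (potential L lam Ω) (profile (jmapE hL vp)) (derE (jmapE hL vp)) vp.1.1 vp.1.2 :=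
    (linForm_congr_ae L _ _ (Eventually.of_forall fun y => congrFun hprof y) hae).symm
  have e2 : linForm L (drift a Ωs) (potential L lam Ωs) vp.1.1 vp.1.2 vp.1.1 vp.1.2 =
      linForm L (drift a Ωs) (potential L lam Ωs) (profile (jmapE hL vp)) (derE (jmapE hL vp)) vp.1.1 vp.1.2 :=
    (linForm_congr_ae L _ _ (Eventually.of_forall fun y => congrFun hprof y) hae).symm
  have key := weakForm_reencodeE hL lam a hc hcs u hsum F' (jmapE hL vp) vp.2.1 vp.2.2
  rw [e2, key, ← e1]
  exact hG

include hc hcs hsum in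
/-- **The even weak image re-encoded.** `IsWeakImageE` (selfsim's «`A⁺(u_R + iu_I) = F` weakly on zero-mass even tests») holds in the `Ω*` encoding
iff in the centre encoding, for the same energy-space pair and the same datum. [folklore] -/
theorem isWeakImageE_reencode (F' : EspE L hL →L[ℝ] W L) (P : WithLp 2 (EspE L hL × EspE L hL)) (G : Wc L) :
    IsWeakImageE hL (-PopCE hL lam a hcs + F') (drift a Ωs) (potential L lam Ωs) P G ↔
      IsWeakImageE hL (-PopCE hL lam a hc + F' + secondVariationE hL a u) (drift a Ω) (potential L lam Ω) P G := by
  constructor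
  · intro hW v v₁ hv h0
    obtain ⟨h1, h2⟩ := hW v v₁ hv h0
    rw [weakForm_reencodeE hL lam a hc hcs u hsum F' P.fst hv h0] at h1
    rw [weakForm_reencodeE hL lam a hc hcs u hsum F' P.snd hv h0] at h2
    exact ⟨h1, h2⟩
  · intro hW v v₁ hv h0
    obtain ⟨h1, h2⟩ := hW v v₁ hv h0
    rw [← weakForm_reencodeE hL lam a hc hcs u hsum F' P.fst hv h0] at h1
    rw [← weakForm_reencodeE hL lam a hc hcs u hsum F' P.snd hv h0] at h2
    exact ⟨h1, h2⟩

/-! ### §4 The pair solution operators, the resolvents and the Evans functions of the two encodings coincide -/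

include hc hcs hsum in
/-- **The even pair solution operators coincide.** For data of the two encodings with the same `m` (the output of `gardingDataKE_reencode` has the
same `(c, m)` as its input) and `Re σ > −m`: `pairOpKE` of the `Ω*` encoding equals `pairOpKE` of the centre encoding — the shifted weak pair
systems coincide test by test (`weakForm_reencodeE` + `linForm_shiftE`), so uniqueness (`pairOpKE_unique`) applies. [folklore] -/
theorem pairOpKE_reencode (F' : EspE L hL →L[ℝ] W L) {D₀ D₁ V₀ c D₀' D₁' V₀' c' m : ℝ}
    (h₁ : GardingDataKE L hL (drift a Ω) (potential L lam Ω) (-PopCE hL lam a hc + F' + secondVariationE hL a u) D₀ D₁ V₀ c m)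
    (h₂ : GardingDataKE L hL (drift a Ωs) (potential L lam Ωs) (-PopCE hL lam a hcs + F') D₀' D₁' V₀' c' m)
    {σ : ℂ} (hσ : -m < σ.re) (G : WithLp 2 (W L × W L)) :
    pairOpKE hL _ h₂ σ hσ G = pairOpKE hL _ h₁ σ hσ G := by
  set Q := pairOpKE hL _ h₁ σ hσ G with hQ
  refine (pairOpKE_unique hL _ h₂ σ hσ G (Q := Q) fun v v₁ hv h0 => ?_).symm
  obtain ⟨e1, e2⟩ := (pairOpKE_spec hL _ h₁ σ hσ).1 G v v₁ hv h0
  have hva := hv.toIsCompactTestAny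
  obtain ⟨-, s11⟩ := linForm_shiftE h₁ σ.re hva Q.fst
  obtain ⟨-, s12⟩ := linForm_shiftE h₁ σ.re hva Q.snd
  obtain ⟨-, s21⟩ := linForm_shiftE h₂ σ.re hva Q.fst
  obtain ⟨-, s22⟩ := linForm_shiftE h₂ σ.re hva Q.snd
  have r1 := weakForm_reencodeE hL lam a hc hcs u hsum F' Q.fst hv h0
  have r2 := weakForm_reencodeE hL lam a hc hcs u hsum F' Q.snd hv h0
  rw [s11] at e1
  rw [s12] at e2
  rw [s21, s22]
  constructor
  · linarith
  · linarith

include hc hcs hsum in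
/-- **The even resolvents coincide** (as bounded operators on `L²_w(ℂ)`, everywhere in `σ`: both vanish off the common half-plane `Re σ > −m`). [folklore] -/
theorem resolventKE_reencode (F' : EspE L hL →L[ℝ] W L) {D₀ D₁ V₀ c D₀' D₁' V₀' c' m : ℝ}
    (h₁ : GardingDataKE L hL (drift a Ω) (potential L lam Ω) (-PopCE hL lam a hc + F' + secondVariationE hL a u) D₀ D₁ V₀ c m)
    (h₂ : GardingDataKE L hL (drift a Ωs) (potential L lam Ωs) (-PopCE hL lam a hcs + F') D₀' D₁' V₀' c' m) (σ : ℂ) :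
    resolventKE hL _ h₂ σ = resolventKE hL _ h₁ σ := by
  ext G : 1
  by_cases hσ : -m < σ.re
  · obtain ⟨e1, -, -, -⟩ := resolventKE_weak hL _ h₁ hσ G
    obtain ⟨e2, -, -, -⟩ := resolventKE_weak hL _ h₂ hσ G
    rw [e1, e2, pairOpKE_reencode hL lam a hc hcs u hsum F' h₁ h₂ hσ]
  · rw [resolventKE_apply, resolventKE_apply, resolventRKE_of_not hL _ h₁ hσ, resolventRKE_of_not hL _ h₂ hσ]

include hc hcs hsum in
/-- **… on the even zero-mass class** (`resolventEven`, the restriction). [folklore] -/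
theorem resolventEven_reencode (F' : EspE L hL →L[ℝ] W L) {D₀ D₁ V₀ c D₀' D₁' V₀' c' m : ℝ}
    (h₁ : GardingDataKE L hL (drift a Ω) (potential L lam Ω) (-PopCE hL lam a hc + F' + secondVariationE hL a u) D₀ D₁ V₀ c m)
    (h₂ : GardingDataKE L hL (drift a Ωs) (potential L lam Ωs) (-PopCE hL lam a hcs + F') D₀' D₁' V₀' c' m) (σ : ℂ) :
    resolventEven hL _ h₂ σ = resolventEven hL _ h₁ σ := by
  ext G : 1
  apply Subtype.ext
  rw [coe_resolventEven, coe_resolventEven, resolventKE_reencode hL lam a hc hcs u hsum F' h₁ h₂ σ]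

include hc hcs hsum in
/-- **THE EVEN EVANS FUNCTIONS OF THE TWO ENCODINGS ARE THE SAME FUNCTION** (every `ℓ, f, θ`). So the (P8⁺) allowance
`‖E⁺_{K̄+B⁺_u} − E⁺_{K̄}‖ ≤ pert⁺`, proved for the centre encoding (`SheetREvenLinearisationPerturbation.evansEven_pert_of_record`), IS the allowance for the
`Ω*`-encoded Evans function whose zero at `σ = ½` is the translation mode (`SheetRTranslationModeWeakEigen`). [folklore] -/
theorem evansEven_reencode (F' : EspE L hL →L[ℝ] W L) {D₀ D₁ V₀ c D₀' D₁' V₀' c' m : ℝ}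
    (h₁ : GardingDataKE L hL (drift a Ω) (potential L lam Ω) (-PopCE hL lam a hc + F' + secondVariationE hL a u) D₀ D₁ V₀ c m)
    (h₂ : GardingDataKE L hL (drift a Ωs) (potential L lam Ωs) (-PopCE hL lam a hcs + F') D₀' D₁' V₀' c' m)
    (ℓ : WcevenZ hL →L[ℂ] ℂ) (f : WcevenZ hL) (θ : ℂ) :
    evansEven hL _ h₂ ℓ f θ = evansEven hL _ h₁ ℓ f θ := by
  funext σ
  rw [evansEven_eq, evansEven_eq]
  simp only [resolventEven_reencode hL lam a hc hcs u hsum F' h₁ h₂ σ]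

include hc hcs hsum in
/-- **Domain and action of Kato's operator do not depend on the encoding**: for data of the two encodings with the same `m` and a base point
`Re σ₀ > −m`, `u ∈ D(T⁺)` for one iff for the other, with the same value (`mem_domainE_iff`, `isWeakImageE_reencode`, `mem_domain_of_weakE`). [folklore] -/
theorem generatorEven_reencode (F' : EspE L hL →L[ℝ] W L) {D₀ D₁ V₀ c D₀' D₁' V₀' c' m : ℝ}
    (h₁ : GardingDataKE L hL (drift a Ω) (potential L lam Ω) (-PopCE hL lam a hc + F' + secondVariationE hL a u) D₀ D₁ V₀ c m)
    (h₂ : GardingDataKE L hL (drift a Ωs) (potential L lam Ωs) (-PopCE hL lam a hcs + F') D₀' D₁' V₀' c' m)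
    {σ₀ : ℂ} (hσ₀ : -m < σ₀.re) {v : WcevenZ hL} (hv : v ∈ (generatorEven hL _ h₂ σ₀ hσ₀).domain) :
    ∃ hv' : v ∈ (generatorEven hL _ h₁ σ₀ hσ₀).domain,
      generatorEven hL _ h₁ σ₀ hσ₀ ⟨v, hv'⟩ = generatorEven hL _ h₂ σ₀ hσ₀ ⟨v, hv⟩ := by
  obtain ⟨P, hP, hw⟩ := weak_of_mem_domainE hL _ h₂ hσ₀ hv
  have hw' := (isWeakImageE_reencode hL lam a hc hcs u hsum F' P _).1 hw
  obtain ⟨hv', hT⟩ := mem_domain_of_weakE hL _ h₁ hσ₀ (u := v) (F := -generatorEven hL _ h₂ σ₀ hσ₀ ⟨v, hv⟩) hP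
    (by rw [Submodule.coe_neg]; exact hw')
  exact ⟨hv', by rw [hT, neg_neg]⟩

end SheetREvenCentreReencoding
end Summit.NavierStokesRegularity.OSWSelfSimilar

end
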